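/-
Copyright: cell `pub-balaban-gaps` (G2), seat ne6 (row NE7b), `prover-pub-balaban-gaps-ne6-g20-0`. Project licence.
-/
import Summits.QuantumFields.BalabanUV.T4Continuum.Spine.NE7b.CompactFibrePlaquetteMassSU2Monotone
import Summits.QuantumFields.BalabanUV.T4Continuum.Spine.NE7b.CompactFibrePlaquetteMassSU2Limit

/-!
# THE FIRST WEAK-COUPLING CORRECTION TO EQUIPARTITION FOR ONE `SU(2)` PLAQUETTE: `β·(3∕2 − β⟨Re tr(1−U)⟩_β) → 3∕16` AS `β → ∞`, AND THE MASS's NEXT TERM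
# `β·((2√π)⁻¹ − β^{3∕2}Z(β)) → (3∕16)(2√π)⁻¹` (row NE7b, node U5c; MODEL, [folklore]; census V54 — `a_2 = 3∕16` certified in the kernel, Bessel-free)

Cell `pub-balaban-gaps` (G2 spine census) for the `pub-balaban` T⁴ crux NE7b (`T4WeightBudget.RelWeightBound`; NOT PRINTED, NOT PROVED).  Crux-route work under
`Spine/NE7b/`; imports the landed V44 `CompactFibrePlaquetteMassSU2Monotone` (the defect identity `weylIntegral_defect_identity`, the Weyl form of the first moment
`integral_traceDeficit_mul_exp_eq`, `hasDerivAt_scaled_plaquetteMass_SU2`) and V45 `CompactFibrePlaquetteMassSU2Limit` (`tendsto_two_mul_mul_one_sub_cos_div_sqrt`,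
`tendsto_scaled_plaquetteMass_SU2`; it re-exports V40e's `integral_exp_neg_traceDeficit_eq`) + Mathlib (dominated convergence, `integral_rpow_mul_exp_neg_mul_rpow`,
Jordan's `Real.cos_le_one_sub_mul_cos_sq`, `Real.one_sub_sq_div_two_le_cos`); no `def`, zero `sorry`, nothing of Bałaban's asserted.

THE LOCATED QUESTION.  V44 proved `β⟨s⟩_β < 3∕2` (`s = Re tr(1 − U)`, one `SU(2)` plaquette under the Wilson weight `e^{−βs}dHaar∕Z(β)`), V49∕J4 the LIMIT `β⟨s⟩_β → 3∕2`,
and gen 19's `g19/ASYMPTOTIC-aN.md` computed FORMALLY (zero weight) `β⟨s⟩_β = (N²−1)∕2 − (N²−1)∕(8Nβ) + O(β⁻²)`.  QUESTION (V54): certify `a_2 = 3∕16` in the kernel.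
ANSWER ([folklore]; `Z(β) = ∫ e^{−βs} dHaar_{SU(2)} = (2∕π)·∫_{(0,π)} e^{−2β(1−cos ψ)} sin²ψ dψ`, `A(β) = ∫_{(0,π)} e^{−2β(1−cos ψ)}(1 − cos ψ)² dψ`, `M(β) = ∫ s·e^{−βs} dHaar`):
* §1 **`integral_pow_four_exp_neg_sq_Ioi`**: `∫₀^∞ u⁴e^{−u²} du = 3√π∕8`; **`tendsto_rescaled_sqDeficit_integrand`**: `β²·e^{−2β(1−cos(u∕√β))}(1 − cos(u∕√β))² → (u⁴∕4)e^{−u²}`;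
* §2 **`scaled_sqDeficit_integral_eq_integral_Ioi`** (`β > 0`): `(√β)⁵·A(β) = ∫_{(0,∞)} 𝟙_{(0,π√β]}(u)·β²·e^{−2β(1−cos(u∕√β))}(1 − cos(u∕√β))² du` (`ψ = u∕√β`);
* §3 **`tendsto_scaled_sqDeficit_integral`**: `(√β)⁵·A(β) → 3√π∕32` — DOMINATED CONVERGENCE with the majorant `(u⁴∕4)·e^{−(4∕π²)u²}` (`2β(1 − cos x) ≤ βx²` and Jordan);
* §4 (Haar currency) **`equipartitionDefect_SU2_eq`** (`β ≥ 0`, EXACT): `(3∕2)·Z(β) − β·M(β) = (1∕π)·A(β)` (V44 §4 + §8);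
* §5 **`tendsto_mul_equipartitionDefect_SU2`**: `β·(3∕2 − β·M(β)∕Z(β)) → 3∕16` — THE FIRST WEAK-COUPLING CORRECTION `β⟨s⟩_β = 3∕2 − 3∕(16β) + o(β⁻¹)` (`lim =
  (1∕π)·(3√π∕32)·(2√π)`); **`eventually_meanAction_SU2_secondOrder`**: for every `ε > 0`, eventually `3∕2 − (3∕16 + ε)∕β < β⟨s⟩_β < 3∕2 − (3∕16 − ε)∕β`;
* §6 **`tendsto_sq_mul_deriv_scaled_plaquetteMass_SU2`**: `β²·((√β)³Z)′(β) → 3∕(32√π) = (3∕16)·(2√π)⁻¹` (the scaled mass climbs to V45∕J3's `(2√π)⁻¹` at that rate);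
* §7 **`scaled_plaquetteMass_SU2_increment_mem`** (Cauchy's mean value theorem against `−x⁻¹`), **`tendsto_mul_limit_sub_scaled_plaquetteMass_SU2`**: `β·((2√π)⁻¹ −
  (√β)³Z(β)) → 3∕(32√π)` — INTEGRATED FORM: J3's sharp ceiling `(2√π)⁻¹β^{−3∕2}` is missed by `(3∕16)(2√π)⁻¹β^{−5∕2}(1 + o(1))` (`T → ∞` through V45's limit; no
  integration on `[β, ∞)`); **`eventually_plaquetteMass_SU2_secondOrder`**: the two-sided window with any `ε > 0`.

HONEST REMARKS.  (i) MODEL ∕ [folklore]: Haar calculus of ONE `SU(2)` plaquette variable; nothing of the interacting measure.  (ii) N = 2 only: for N ≥ 3 the sign of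
the first correction (V52's named residual at large β) is NOT proved — `a_N = (N²−1)∕(8N)` stays formal.  (iii) No third-order term, no uniform-in-β constants (limits
and `ε`-windows only).  (iv) (A3) ∕ (A1c) NOT asserted; NC-NE7b-α UNRULED.  BY-NAME EFFECT ON THE WALL: NONE.  NE7b NOT PRINTED ∕ NOT PROVED; spine PROVED 0∕9; rung (B)+1
on ONE finite T⁴ — NOT infinite volume, NOT the mass gap, NOT Clay.
HONEST DEPENDENCY: continuum YM on T⁴ ⇐ BetaPertH ∧ nine spine estimates (0/9 proved); BetaPertH ⇐ (D1) ∧ (D4) ∧ CAP+tail;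
G-an2-4 gates asym, D1 and NE2/3/4.  This file changes none of it.
-/

set_option autoImplicit false

noncomputable section

open Real Set MeasureTheory Filter Topology
open Literature.MathematicalPhysics.QuantumFieldTheory (haarProbability)
open Summit.QuantumFields.BalabanUV.T4Continuum.NE7b.CompactFibreSU2ClassIntegral (integral_exp_neg_traceDeficit_eq)
open Summit.QuantumFields.BalabanUV.T4Continuum.NE7b.CompactFibrePlaquetteMassSU2Monotone
  (weylIntegral_defect_identity integral_traceDeficit_mul_exp_eq hasDerivAt_scaled_plaquetteMass_SU2 exp_neg_two_mul_le_plaquetteMass_SU2)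
open Summit.QuantumFields.BalabanUV.T4Continuum.NE7b.CompactFibrePlaquetteMassSU2Limit
  (tendsto_two_mul_mul_one_sub_cos_div_sqrt tendsto_scaled_plaquetteMass_SU2)

namespace Summit.QuantumFields.BalabanUV.T4Continuum.NE7b.CompactFibreMeanActionSU2SecondOrder

/-! ### §1 The fourth Gaussian moment and the pointwise limit -/
/-- `∫₀^∞ u⁴e^{−u²} du = 3√π∕8` (`= ½·Γ(5∕2)`; the `β = 1` instance of V47 `CompactFibrePlaquetteMassSU2LaplaceFloor.integral_pow_four_mul_exp_neg_mul_sq`, kept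
self-contained to spare the import). [folklore] -/
theorem integral_pow_four_exp_neg_sq_Ioi :
    ∫ u in Set.Ioi (0 : ℝ), u ^ 4 * Real.exp (-u ^ 2) = 3 * Real.sqrt Real.pi / 8 := by
  have h := integral_rpow_mul_exp_neg_mul_rpow (p := 2) (q := 4) two_pos (by norm_num) one_pos
  have e : ∀ x ∈ Set.Ioi (0 : ℝ), x ^ (4 : ℝ) * Real.exp (-1 * x ^ (2 : ℝ)) = x ^ 4 * Real.exp (-x ^ 2) := by
    intro x _
    rw [show (4 : ℝ) = ((4 : ℕ) : ℝ) by norm_num, show (2 : ℝ) = ((2 : ℕ) : ℝ) by norm_num, Real.rpow_natCast,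
      Real.rpow_natCast, neg_mul, one_mul]
  rw [setIntegral_congr_fun measurableSet_Ioi e] at h
  have hG : Real.Gamma (((4 : ℝ) + 1) / 2) = 3 / 4 * Real.sqrt Real.pi := by
    rw [show ((4 : ℝ) + 1) / 2 = 1 / 2 + 1 + 1 by norm_num, Real.Gamma_add_one (by norm_num : (1 : ℝ) / 2 + 1 ≠ 0),
      Real.Gamma_add_one (by norm_num : (1 : ℝ) / 2 ≠ 0), Real.Gamma_one_half_eq]
    ring
  rw [h, Real.one_rpow, hG]
  ring
/-- `u⁴e^{−bu²}` is integrable on `ℝ` for `b > 0`. [folklore] -/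
theorem integrable_pow_four_mul_exp_neg_mul_sq {b : ℝ} (hb : 0 < b) :
    Integrable (fun u : ℝ => u ^ 4 * Real.exp (-b * u ^ 2)) := by
  have h := integrable_rpow_mul_exp_neg_mul_sq hb (s := 4) (by norm_num)
  refine h.congr (ae_of_all _ fun u => ?_)
  show u ^ (4 : ℝ) * Real.exp (-b * u ^ 2) = u ^ 4 * Real.exp (-b * u ^ 2)
  rw [show (4 : ℝ) = ((4 : ℕ) : ℝ) by norm_num, Real.rpow_natCast]
/-- **The pointwise limit of the rescaled second-moment integrand**: for every real `u`,
`β²·(e^{−2β(1−cos(u∕√β))}·(1 − cos(u∕√β))²) → (u⁴∕4)·e^{−u²}` (from V45's `2β(1 − cos(u∕√β)) → u²`). [folklore] -/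
theorem tendsto_rescaled_sqDeficit_integrand (u : ℝ) :
    Tendsto (fun β : ℝ => β ^ 2 * (Real.exp (-(2 * β * (1 - Real.cos (u / Real.sqrt β)))) * (1 - Real.cos (u / Real.sqrt β)) ^ 2)) atTop
      (𝓝 (u ^ 4 / 4 * Real.exp (-u ^ 2))) := by
  have h1 := tendsto_two_mul_mul_one_sub_cos_div_sqrt u
  have h2 : Tendsto (fun β : ℝ => Real.exp (-(2 * β * (1 - Real.cos (u / Real.sqrt β))))) atTop (𝓝 (Real.exp (-u ^ 2))) :=
    (Real.continuous_exp.tendsto _).comp h1.neg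
  have h := ((h1.pow 2).mul h2).const_mul (1 / 4)
  have e1 : (1 / 4 : ℝ) * ((u ^ 2) ^ 2 * Real.exp (-u ^ 2)) = u ^ 4 / 4 * Real.exp (-u ^ 2) := by ring
  rw [e1] at h
  refine h.congr fun β => ?_
  ring

/-! ### §2 The substitution `ψ = u∕√β` -/
/-- **`(√β)⁵·A(β)` AS AN INTEGRAL OVER `(0, ∞)`**: for `β > 0`,
`(√β)⁵·∫_{(0,π)} e^{−2β(1−cos ψ)}(1 − cos ψ)² dψ = ∫_{(0,∞)} 𝟙_{(0,π√β]}(u)·β²·e^{−2β(1−cos(u∕√β))}(1 − cos(u∕√β))² du`. [folklore] -/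
theorem scaled_sqDeficit_integral_eq_integral_Ioi {β : ℝ} (hβ : 0 < β) :
    Real.sqrt β ^ 5 * ∫ ψ in Set.Ioo 0 Real.pi, Real.exp (-(2 * β * (1 - Real.cos ψ))) * (1 - Real.cos ψ) ^ 2
      = ∫ u in Set.Ioi (0 : ℝ), (Set.Ioc 0 (Real.pi * Real.sqrt β)).indicator
          (fun u => β ^ 2 * (Real.exp (-(2 * β * (1 - Real.cos (u / Real.sqrt β)))) * (1 - Real.cos (u / Real.sqrt β)) ^ 2)) u := by
  have hπ := Real.pi_pos
  have hs : 0 < Real.sqrt β := Real.sqrt_pos.2 hβ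
  have hs2 : Real.sqrt β ^ 2 = β := Real.sq_sqrt hβ.le
  have hsub := intervalIntegral.integral_comp_div (a := 0) (b := Real.pi * Real.sqrt β)
    (fun ψ : ℝ => Real.exp (-(2 * β * (1 - Real.cos ψ))) * (1 - Real.cos ψ) ^ 2) hs.ne'
  rw [zero_div, mul_div_cancel_right₀ _ hs.ne', smul_eq_mul] at hsub
  have hG : ∫ ψ in Set.Ioo 0 Real.pi, Real.exp (-(2 * β * (1 - Real.cos ψ))) * (1 - Real.cos ψ) ^ 2
      = (Real.sqrt β)⁻¹ * ∫ u in (0 : ℝ)..Real.pi * Real.sqrt β,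
          Real.exp (-(2 * β * (1 - Real.cos (u / Real.sqrt β)))) * (1 - Real.cos (u / Real.sqrt β)) ^ 2 := by
    rw [hsub, ← mul_assoc, inv_mul_cancel₀ hs.ne', one_mul, intervalIntegral.integral_of_le hπ.le, integral_Ioc_eq_integral_Ioo]
  rw [hG, setIntegral_indicator measurableSet_Ioc, Set.inter_eq_right.2 Set.Ioc_subset_Ioi_self,
    ← intervalIntegral.integral_of_le (by positivity), intervalIntegral.integral_const_mul, ← mul_assoc]
  congr 1
  rw [pow_succ, mul_assoc, mul_inv_cancel₀ hs.ne', mul_one, show (4 : ℕ) = 2 * 2 from rfl, pow_mul, hs2]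

/-! ### §3 Dominated convergence: `(√β)⁵·A(β) → 3√π∕32` -/
/-- **THE LAPLACE LIMIT OF THE DEFICIT's SECOND MOMENT**: `(√β)⁵·∫_{(0,π)} e^{−2β(1−cos ψ)}(1 − cos ψ)² dψ → ∫₀^∞ (u⁴∕4)e^{−u²} du = 3√π∕32` as `β → ∞`
(dominated convergence after `ψ = u∕√β`; majorant `(u⁴∕4)·e^{−(4∕π²)u²}` from `1 − cos x ≤ x²∕2` and Jordan's `1 − cos x ≥ (2∕π²)x²` on `[0, π]`). [folklore] -/
theorem tendsto_scaled_sqDeficit_integral :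
    Tendsto (fun β : ℝ => Real.sqrt β ^ 5 * ∫ ψ in Set.Ioo 0 Real.pi, Real.exp (-(2 * β * (1 - Real.cos ψ))) * (1 - Real.cos ψ) ^ 2) atTop
      (𝓝 (3 * Real.sqrt Real.pi / 32)) := by
  have hπ := Real.pi_pos
  set F : ℝ → ℝ → ℝ := fun β u => (Set.Ioc 0 (Real.pi * Real.sqrt β)).indicator
    (fun u => β ^ 2 * (Real.exp (-(2 * β * (1 - Real.cos (u / Real.sqrt β)))) * (1 - Real.cos (u / Real.sqrt β)) ^ 2)) u with hF
  have hcont : ∀ β : ℝ, Continuous fun u : ℝ =>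
      β ^ 2 * (Real.exp (-(2 * β * (1 - Real.cos (u / Real.sqrt β)))) * (1 - Real.cos (u / Real.sqrt β)) ^ 2) := fun β => by fun_prop
  have hF_meas : ∀ᶠ β in atTop, AEStronglyMeasurable (F β) (volume.restrict (Set.Ioi (0 : ℝ))) :=
    Filter.Eventually.of_forall fun β => ((hcont β).aestronglyMeasurable).indicator measurableSet_Ioc
  -- domination by the Gaussian majorant
  have h_bound : ∀ᶠ β in atTop, ∀ᵐ u ∂(volume.restrict (Set.Ioi (0 : ℝ))), ‖F β u‖ ≤ u ^ 4 / 4 * Real.exp (-(4 / Real.pi ^ 2) * u ^ 2) := by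
    filter_upwards [eventually_gt_atTop (0 : ℝ)] with β hβ
    refine ae_of_all _ fun u => ?_
    have hs : 0 < Real.sqrt β := Real.sqrt_pos.2 hβ
    have hs2 : Real.sqrt β ^ 2 = β := Real.sq_sqrt hβ.le
    by_cases hu : u ∈ Set.Ioc 0 (Real.pi * Real.sqrt β)
    · have hψ0 : 0 ≤ u / Real.sqrt β := div_nonneg hu.1.le hs.le
      have hx2 : (u / Real.sqrt β) ^ 2 = u ^ 2 / β := by rw [div_pow, hs2]
      -- `0 ≤ 2β(1 − cos x) ≤ βx² = u²`
      have hc0 : 0 ≤ 2 * β * (1 - Real.cos (u / Real.sqrt β)) := by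
        have : 0 ≤ 1 - Real.cos (u / Real.sqrt β) := by linarith [Real.cos_le_one (u / Real.sqrt β)]
        positivity
      have hc1 : 2 * β * (1 - Real.cos (u / Real.sqrt β)) ≤ u ^ 2 := by
        have hcos := Real.one_sub_sq_div_two_le_cos (x := u / Real.sqrt β)
        rw [hx2] at hcos
        have h' : 1 - Real.cos (u / Real.sqrt β) ≤ u ^ 2 / β / 2 := by linarith
        calc 2 * β * (1 - Real.cos (u / Real.sqrt β)) ≤ 2 * β * (u ^ 2 / β / 2) := mul_le_mul_of_nonneg_left h' (by positivity)
          _ = u ^ 2 := by field_simp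
      -- Jordan: `e^{−2β(1−cos x)} ≤ e^{−(4∕π²)u²}`
      have hj := Real.cos_le_one_sub_mul_cos_sq (show |u / Real.sqrt β| ≤ Real.pi by
        rw [abs_of_nonneg hψ0]; exact (div_le_iff₀ hs).2 hu.2)
      rw [hx2] at hj
      have he : Real.exp (-(2 * β * (1 - Real.cos (u / Real.sqrt β)))) ≤ Real.exp (-(4 / Real.pi ^ 2) * u ^ 2) := by
        refine Real.exp_le_exp.2 ?_
        have h' : 2 / Real.pi ^ 2 * (u ^ 2 / β) ≤ 1 - Real.cos (u / Real.sqrt β) := by linarith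
        have h2 := mul_le_mul_of_nonneg_left h' (by positivity : (0 : ℝ) ≤ 2 * β)
        have e : 2 * β * (2 / Real.pi ^ 2 * (u ^ 2 / β)) = 4 / Real.pi ^ 2 * u ^ 2 := by field_simp; ring
        rw [neg_mul]; linarith
      have hsq : (2 * β * (1 - Real.cos (u / Real.sqrt β))) ^ 2 ≤ (u ^ 2) ^ 2 := pow_le_pow_left₀ hc0 hc1 2
      simp only [hF, Set.indicator_of_mem hu, Real.norm_eq_abs]
      rw [abs_of_nonneg (by positivity)]
      calc β ^ 2 * (Real.exp (-(2 * β * (1 - Real.cos (u / Real.sqrt β)))) * (1 - Real.cos (u / Real.sqrt β)) ^ 2)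
          = (2 * β * (1 - Real.cos (u / Real.sqrt β))) ^ 2 / 4 * Real.exp (-(2 * β * (1 - Real.cos (u / Real.sqrt β)))) := by ring
        _ ≤ (u ^ 2) ^ 2 / 4 * Real.exp (-(4 / Real.pi ^ 2) * u ^ 2) :=
            mul_le_mul (div_le_div_of_nonneg_right hsq (by norm_num)) he (Real.exp_pos _).le (by positivity)
        _ = u ^ 4 / 4 * Real.exp (-(4 / Real.pi ^ 2) * u ^ 2) := by ring
    · simp only [hF, Set.indicator_of_notMem hu, norm_zero]
      positivity
  have hint : Integrable (fun u : ℝ => u ^ 4 / 4 * Real.exp (-(4 / Real.pi ^ 2) * u ^ 2)) (volume.restrict (Set.Ioi (0 : ℝ))) := by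
    have h := (integrable_pow_four_mul_exp_neg_mul_sq (by positivity : (0 : ℝ) < 4 / Real.pi ^ 2)).div_const 4
    have h' : Integrable (fun u : ℝ => u ^ 4 / 4 * Real.exp (-(4 / Real.pi ^ 2) * u ^ 2)) :=
      h.congr (ae_of_all _ fun u => by
        show u ^ 4 * Real.exp (-(4 / Real.pi ^ 2) * u ^ 2) / 4 = u ^ 4 / 4 * Real.exp (-(4 / Real.pi ^ 2) * u ^ 2)
        ring)
    exact h'.restrict
  -- pointwise limits on `(0, ∞)`
  have h_lim : ∀ᵐ u ∂(volume.restrict (Set.Ioi (0 : ℝ))), Tendsto (fun β => F β u) atTop (𝓝 (1 / 4 * (u ^ 4 * Real.exp (-u ^ 2)))) := by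
    refine ae_restrict_of_forall_mem measurableSet_Ioi fun u hu => ?_
    have hu0 : 0 < u := hu
    have hlim := tendsto_rescaled_sqDeficit_integrand u
    rw [show u ^ 4 / 4 * Real.exp (-u ^ 2) = 1 / 4 * (u ^ 4 * Real.exp (-u ^ 2)) by ring] at hlim
    refine hlim.congr' ?_
    filter_upwards [eventually_ge_atTop ((u / Real.pi) ^ 2), eventually_gt_atTop (0 : ℝ)] with β hβu hβ0
    have hmem : u ∈ Set.Ioc 0 (Real.pi * Real.sqrt β) := by
      refine ⟨hu0, ?_⟩
      have := Real.le_sqrt_of_sq_le hβu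
      rwa [div_le_iff₀' hπ] at this
    simp only [hF, Set.indicator_of_mem hmem]
  have hDCT := tendsto_integral_filter_of_dominated_convergence (fun u : ℝ => u ^ 4 / 4 * Real.exp (-(4 / Real.pi ^ 2) * u ^ 2))
    hF_meas h_bound hint h_lim
  rw [integral_const_mul, integral_pow_four_exp_neg_sq_Ioi, show (1 / 4 : ℝ) * (3 * Real.sqrt Real.pi / 8) = 3 * Real.sqrt Real.pi / 32 by ring] at hDCT
  refine hDCT.congr' ?_
  filter_upwards [eventually_gt_atTop (0 : ℝ)] with β hβ
  simp only [hF]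
  exact (scaled_sqDeficit_integral_eq_integral_Ioi hβ).symm

/-! ### §4 Haar currency: the equipartition defect is `A(β)∕π`, exactly -/
/-- **THE EQUIPARTITION DEFECT IN HAAR CURRENCY** (exact, every `β ≥ 0`):
`(3∕2)·∫ e^{−β·Re tr(1−U)} dHaar_{SU(2)} − β·∫ Re tr(1−U)·e^{−β·Re tr(1−U)} dHaar_{SU(2)} = (1∕π)·∫_{(0,π)} e^{−2β(1−cos ψ)}(1 − cos ψ)² dψ`
(V44's defect identity `(3∕2)G + βG′ = ½A` with `Z = (2∕π)G`, `M = −(2∕π)G′`). [folklore] -/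
theorem equipartitionDefect_SU2_eq {β : ℝ} (hβ : 0 ≤ β) :
    3 / 2 * (∫ U, Real.exp (-(β * (Matrix.trace (1 - (U : Matrix (Fin 2) (Fin 2) ℂ))).re)) ∂(haarProbability (Matrix.specialUnitaryGroup (Fin 2) ℂ)))
      - β * ∫ U, (Matrix.trace (1 - (U : Matrix (Fin 2) (Fin 2) ℂ))).re * Real.exp (-(β * (Matrix.trace (1 - (U : Matrix (Fin 2) (Fin 2) ℂ))).re))
          ∂(haarProbability (Matrix.specialUnitaryGroup (Fin 2) ℂ))
      = 1 / Real.pi * ∫ ψ in Set.Ioo 0 Real.pi, Real.exp (-(2 * β * (1 - Real.cos ψ))) * (1 - Real.cos ψ) ^ 2 := by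
  rw [integral_traceDeficit_mul_exp_eq hβ, integral_exp_neg_traceDeficit_eq hβ]
  have hid := weylIntegral_defect_identity β
  have hneg : ∫ ψ in Set.Ioo 0 Real.pi, 2 * (1 - Real.cos ψ) * Real.exp (-(2 * β * (1 - Real.cos ψ))) * Real.sin ψ ^ 2
      = -(∫ ψ in Set.Ioo 0 Real.pi, -(2 * (1 - Real.cos ψ)) * Real.exp (-(2 * β * (1 - Real.cos ψ))) * Real.sin ψ ^ 2) := by
    rw [← integral_neg]
    exact integral_congr_ae (ae_of_all _ fun ψ => by ring)
  rw [hneg]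
  linear_combination (2 / Real.pi) * hid
/-- The one-plaquette mass is positive: `0 < ∫ e^{−β·Re tr(1−U)} dHaar_{SU(2)}` (`β ≥ 0`; V44's tangent floor `e^{−2β} ≤ Z(β)`). [folklore] -/
theorem plaquetteMass_SU2_pos {β : ℝ} (hβ : 0 ≤ β) :
    0 < ∫ U, Real.exp (-(β * (Matrix.trace (1 - (U : Matrix (Fin 2) (Fin 2) ℂ))).re)) ∂(haarProbability (Matrix.specialUnitaryGroup (Fin 2) ℂ)) :=
  lt_of_lt_of_le (Real.exp_pos _) (exp_neg_two_mul_le_plaquetteMass_SU2 hβ)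

/-! ### §5 `a_2 = 3∕16`: the first weak-coupling correction to equipartition -/
/-- **THE FIRST WEAK-COUPLING CORRECTION TO EQUIPARTITION, `SU(2)`, ONE PLAQUETTE UNDER HAAR**:
`β·(3∕2 − β·(∫ Re tr(1−U)·e^{−β Re tr(1−U)} dHaar)∕(∫ e^{−β Re tr(1−U)} dHaar)) → 3∕16` as `β → ∞` — i.e. `β⟨Re tr(1−U)⟩_β = 3∕2 − 3∕(16β) + o(1∕β)`:
the mean action sits below its Gaussian equipartition value `3∕(2β)` (V44) by exactly `3∕(16β²)` to leading order (`a_2 = (N²−1)∕(8N)` at `N = 2`; §3 + §4 + V45: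
`lim = (1∕π)·(3√π∕32)∕(2√π)⁻¹ = 3∕16`). [folklore] -/
theorem tendsto_mul_equipartitionDefect_SU2 :
    Tendsto (fun β : ℝ => β * (3 / 2 - β *
        (∫ U, (Matrix.trace (1 - (U : Matrix (Fin 2) (Fin 2) ℂ))).re * Real.exp (-(β * (Matrix.trace (1 - (U : Matrix (Fin 2) (Fin 2) ℂ))).re))
          ∂(haarProbability (Matrix.specialUnitaryGroup (Fin 2) ℂ)))
        / (∫ U, Real.exp (-(β * (Matrix.trace (1 - (U : Matrix (Fin 2) (Fin 2) ℂ))).re)) ∂(haarProbability (Matrix.specialUnitaryGroup (Fin 2) ℂ)))))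
      atTop (𝓝 (3 / 16)) := by
  have hsπ : 0 < Real.sqrt Real.pi := Real.sqrt_pos.2 Real.pi_pos
  have hss : Real.sqrt Real.pi * Real.sqrt Real.pi = Real.pi := Real.mul_self_sqrt Real.pi_pos.le
  have hK : (2 * Real.sqrt Real.pi)⁻¹ ≠ 0 := by positivity
  have h := (tendsto_scaled_sqDeficit_integral.const_mul (1 / Real.pi)).mul (tendsto_scaled_plaquetteMass_SU2.inv₀ hK)
  have e : 1 / Real.pi * (3 * Real.sqrt Real.pi / 32) * ((2 * Real.sqrt Real.pi)⁻¹)⁻¹ = 3 / 16 := by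
    rw [inv_inv]
    field_simp
    nlinarith [hss]
  rw [e] at h
  refine h.congr' ?_
  filter_upwards [eventually_gt_atTop (0 : ℝ)] with β hβ
  have hsne : Real.sqrt β ≠ 0 := (Real.sqrt_pos.2 hβ).ne'
  have hs2 : Real.sqrt β ^ 2 = β := Real.sq_sqrt hβ.le
  have hZne := (plaquetteMass_SU2_pos hβ.le).ne'
  have hid := equipartitionDefect_SU2_eq hβ.le
  have e5 : Real.sqrt β ^ 5 = β * Real.sqrt β ^ 3 := by
    rw [show (5 : ℕ) = 2 + 3 from rfl, pow_add, hs2]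
  have hM : β * ∫ U, (Matrix.trace (1 - (U : Matrix (Fin 2) (Fin 2) ℂ))).re * Real.exp (-(β * (Matrix.trace (1 - (U : Matrix (Fin 2) (Fin 2) ℂ))).re))
          ∂(haarProbability (Matrix.specialUnitaryGroup (Fin 2) ℂ))
      = 3 / 2 * (∫ U, Real.exp (-(β * (Matrix.trace (1 - (U : Matrix (Fin 2) (Fin 2) ℂ))).re)) ∂(haarProbability (Matrix.specialUnitaryGroup (Fin 2) ℂ)))
        - 1 / Real.pi * ∫ ψ in Set.Ioo 0 Real.pi, Real.exp (-(2 * β * (1 - Real.cos ψ))) * (1 - Real.cos ψ) ^ 2 := by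
    linarith
  rw [hM, e5]
  field_simp
  ring
/-- Real arithmetic of the two-sided window: `3∕16 − ε < β(3∕2 − x) < 3∕16 + ε` and `β > 0` give `3∕2 − (3∕16 + ε)∕β < x < 3∕2 − (3∕16 − ε)∕β`. -/
theorem window_of_lt_of_lt {β x ε : ℝ} (hβ : 0 < β) (h1 : 3 / 16 - ε < β * (3 / 2 - x)) (h2 : β * (3 / 2 - x) < 3 / 16 + ε) :
    3 / 2 - (3 / 16 + ε) / β < x ∧ x < 3 / 2 - (3 / 16 - ε) / β := by
  have hl : 3 / 2 - x < (3 / 16 + ε) / β := by rw [lt_div_iff₀ hβ]; linarith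
  have hr : (3 / 16 - ε) / β < 3 / 2 - x := by rw [div_lt_iff₀ hβ]; linarith
  constructor <;> linarith
/-- **TWO-SIDED SECOND-ORDER WINDOW FOR THE MEAN ACTION**: for every `ε > 0`, eventually in `β`,
`3∕2 − (3∕16 + ε)∕β < β⟨Re tr(1−U)⟩_β < 3∕2 − (3∕16 − ε)∕β`. [folklore] -/
theorem eventually_meanAction_SU2_secondOrder {ε : ℝ} (hε : 0 < ε) :
    ∀ᶠ β : ℝ in atTop,
      3 / 2 - (3 / 16 + ε) / β < β *
          (∫ U, (Matrix.trace (1 - (U : Matrix (Fin 2) (Fin 2) ℂ))).re * Real.exp (-(β * (Matrix.trace (1 - (U : Matrix (Fin 2) (Fin 2) ℂ))).re))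
            ∂(haarProbability (Matrix.specialUnitaryGroup (Fin 2) ℂ)))
          / (∫ U, Real.exp (-(β * (Matrix.trace (1 - (U : Matrix (Fin 2) (Fin 2) ℂ))).re)) ∂(haarProbability (Matrix.specialUnitaryGroup (Fin 2) ℂ)))
      ∧ β * (∫ U, (Matrix.trace (1 - (U : Matrix (Fin 2) (Fin 2) ℂ))).re * Real.exp (-(β * (Matrix.trace (1 - (U : Matrix (Fin 2) (Fin 2) ℂ))).re))
            ∂(haarProbability (Matrix.specialUnitaryGroup (Fin 2) ℂ)))
          / (∫ U, Real.exp (-(β * (Matrix.trace (1 - (U : Matrix (Fin 2) (Fin 2) ℂ))).re)) ∂(haarProbability (Matrix.specialUnitaryGroup (Fin 2) ℂ)))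
        < 3 / 2 - (3 / 16 - ε) / β := by
  have h := tendsto_mul_equipartitionDefect_SU2
  have hlo := h.eventually_const_lt (show (3 : ℝ) / 16 - ε < 3 / 16 by linarith)
  have hhi := h.eventually_lt_const (show (3 : ℝ) / 16 < 3 / 16 + ε by linarith)
  filter_upwards [hlo, hhi, eventually_gt_atTop (0 : ℝ)] with β h1 h2 hβ
  exact window_of_lt_of_lt hβ h1 h2

/-! ### §6 The same number in the mass's derivative -/
/-- **THE SCALED MASS CLIMBS TO `(2√π)⁻¹` AT THE RATE `(3∕16)(2√π)⁻¹β⁻²` (DERIVATIVE FORM)**: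
`β²·((√β)³·∫ e^{−β Re tr(1−U)} dHaar_{SU(2)})′(β) → 3∕(32√π) = (3∕16)·(2√π)⁻¹` as `β → ∞` (V44 §6: `f′(β) = (√β∕π)·A(β)`; §3). [folklore] -/
theorem tendsto_sq_mul_deriv_scaled_plaquetteMass_SU2 :
    Tendsto (fun β : ℝ => β ^ 2 * deriv (fun b : ℝ => Real.sqrt b ^ 3 *
        ∫ U, Real.exp (-(b * (Matrix.trace (1 - (U : Matrix (Fin 2) (Fin 2) ℂ))).re)) ∂(haarProbability (Matrix.specialUnitaryGroup (Fin 2) ℂ))) β)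
      atTop (𝓝 (3 / (32 * Real.sqrt Real.pi))) := by
  have hsπ : 0 < Real.sqrt Real.pi := Real.sqrt_pos.2 Real.pi_pos
  have hss : Real.sqrt Real.pi * Real.sqrt Real.pi = Real.pi := Real.mul_self_sqrt Real.pi_pos.le
  have h := tendsto_scaled_sqDeficit_integral.const_mul (1 / Real.pi)
  have e : 1 / Real.pi * (3 * Real.sqrt Real.pi / 32) = 3 / (32 * Real.sqrt Real.pi) := by
    field_simp
    nlinarith [hss]
  rw [e] at h
  refine h.congr' ?_
  filter_upwards [eventually_gt_atTop (0 : ℝ)] with β hβ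
  have hs2 : Real.sqrt β ^ 2 = β := Real.sq_sqrt hβ.le
  rw [(hasDerivAt_scaled_plaquetteMass_SU2 hβ).deriv]
  have e5 : Real.sqrt β ^ 5 = β ^ 2 * Real.sqrt β := by
    rw [show (5 : ℕ) = 2 * 2 + 1 from rfl, pow_succ, pow_mul, hs2]
  rw [e5]
  ring

/-! ### §7 The integrated form: `β·((2√π)⁻¹ − (√β)³Z(β)) → 3∕(32√π)` -/
/-- **MEAN-VALUE BRACKET** (Cauchy's mean value theorem against `−x⁻¹`): if `L₁ ≤ x²·((√x)³Z)′(x) ≤ L₂` for all `x ≥ β₀ > 0` (`((√x)³Z)′(x) = (√x∕π)·A(x)`, V44 §6),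
then for `β₀ ≤ β < T`: `L₁·(β⁻¹ − T⁻¹) ≤ (√T)³Z(T) − (√β)³Z(β) ≤ L₂·(β⁻¹ − T⁻¹)`. [folklore] -/
theorem scaled_plaquetteMass_SU2_increment_mem {β₀ L₁ L₂ β T : ℝ} (hβ₀ : 0 < β₀)
    (hL : ∀ x : ℝ, β₀ ≤ x → L₁ ≤ x ^ 2 * (Real.sqrt x / Real.pi * ∫ ψ in Set.Ioo 0 Real.pi, Real.exp (-(2 * x * (1 - Real.cos ψ))) * (1 - Real.cos ψ) ^ 2) ∧ x ^ 2 * (Real.sqrt x / Real.pi * ∫ ψ in Set.Ioo 0 Real.pi, Real.exp (-(2 * x * (1 - Real.cos ψ))) * (1 - Real.cos ψ) ^ 2) ≤ L₂)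
    (hβ : β₀ ≤ β) (hT : β < T) :
    L₁ * (β⁻¹ - T⁻¹) ≤ Real.sqrt T ^ 3 * ∫ U, Real.exp (-(T * (Matrix.trace (1 - (U : Matrix (Fin 2) (Fin 2) ℂ))).re)) ∂(haarProbability (Matrix.specialUnitaryGroup (Fin 2) ℂ)) - Real.sqrt β ^ 3 * ∫ U, Real.exp (-(β * (Matrix.trace (1 - (U : Matrix (Fin 2) (Fin 2) ℂ))).re)) ∂(haarProbability (Matrix.specialUnitaryGroup (Fin 2) ℂ))
      ∧ Real.sqrt T ^ 3 * ∫ U, Real.exp (-(T * (Matrix.trace (1 - (U : Matrix (Fin 2) (Fin 2) ℂ))).re)) ∂(haarProbability (Matrix.specialUnitaryGroup (Fin 2) ℂ)) - Real.sqrt β ^ 3 * ∫ U, Real.exp (-(β * (Matrix.trace (1 - (U : Matrix (Fin 2) (Fin 2) ℂ))).re)) ∂(haarProbability (Matrix.specialUnitaryGroup (Fin 2) ℂ)) ≤ L₂ * (β⁻¹ - T⁻¹) := by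
  have hβp : 0 < β := hβ₀.trans_le hβ
  have hd : ∀ x : ℝ, 0 < x → HasDerivAt (fun b : ℝ => Real.sqrt b ^ 3 * ∫ U, Real.exp (-(b * (Matrix.trace (1 - (U : Matrix (Fin 2) (Fin 2) ℂ))).re)) ∂(haarProbability (Matrix.specialUnitaryGroup (Fin 2) ℂ)))
      (Real.sqrt x / Real.pi * ∫ ψ in Set.Ioo 0 Real.pi, Real.exp (-(2 * x * (1 - Real.cos ψ))) * (1 - Real.cos ψ) ^ 2) x := fun x hx => hasDerivAt_scaled_plaquetteMass_SU2 hx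
  have hfc : ContinuousOn (fun b : ℝ => Real.sqrt b ^ 3 * ∫ U, Real.exp (-(b * (Matrix.trace (1 - (U : Matrix (Fin 2) (Fin 2) ℂ))).re)) ∂(haarProbability (Matrix.specialUnitaryGroup (Fin 2) ℂ))) (Set.Icc β T) :=
    fun x hx => (hd x (hβp.trans_le hx.1)).continuousAt.continuousWithinAt
  have hff' : ∀ x ∈ Set.Ioo β T, HasDerivAt (fun b : ℝ => Real.sqrt b ^ 3 * ∫ U, Real.exp (-(b * (Matrix.trace (1 - (U : Matrix (Fin 2) (Fin 2) ℂ))).re)) ∂(haarProbability (Matrix.specialUnitaryGroup (Fin 2) ℂ)))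
      (Real.sqrt x / Real.pi * ∫ ψ in Set.Ioo 0 Real.pi, Real.exp (-(2 * x * (1 - Real.cos ψ))) * (1 - Real.cos ψ) ^ 2) x := fun x hx => hd x (hβp.trans hx.1)
  have hgc : ContinuousOn (fun x : ℝ => -x⁻¹) (Set.Icc β T) :=
    fun x hx => ((hasDerivAt_inv (hβp.trans_le hx.1).ne').neg).continuousAt.continuousWithinAt
  have hgg' : ∀ x ∈ Set.Ioo β T, HasDerivAt (fun x : ℝ => -x⁻¹) ((x ^ 2)⁻¹) x := fun x hx => by
    have h := (hasDerivAt_inv (hβp.trans hx.1).ne').neg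
    rw [neg_neg] at h
    exact h
  obtain ⟨c, hc, heq⟩ := exists_ratio_hasDerivAt_eq_ratio_slope (fun b : ℝ => Real.sqrt b ^ 3 * ∫ U, Real.exp (-(b * (Matrix.trace (1 - (U : Matrix (Fin 2) (Fin 2) ℂ))).re)) ∂(haarProbability (Matrix.specialUnitaryGroup (Fin 2) ℂ)))
    (fun x : ℝ => Real.sqrt x / Real.pi * ∫ ψ in Set.Ioo 0 Real.pi, Real.exp (-(2 * x * (1 - Real.cos ψ))) * (1 - Real.cos ψ) ^ 2) hT hfc hff'
    (fun x : ℝ => -x⁻¹) (fun x : ℝ => (x ^ 2)⁻¹) hgc hgg'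
  have hc0 : 0 < c := hβp.trans hc.1
  have hceq : Real.sqrt T ^ 3 * ∫ U, Real.exp (-(T * (Matrix.trace (1 - (U : Matrix (Fin 2) (Fin 2) ℂ))).re)) ∂(haarProbability (Matrix.specialUnitaryGroup (Fin 2) ℂ)) - Real.sqrt β ^ 3 * ∫ U, Real.exp (-(β * (Matrix.trace (1 - (U : Matrix (Fin 2) (Fin 2) ℂ))).re)) ∂(haarProbability (Matrix.specialUnitaryGroup (Fin 2) ℂ))
      = c ^ 2 * (Real.sqrt c / Real.pi * ∫ ψ in Set.Ioo 0 Real.pi, Real.exp (-(2 * c * (1 - Real.cos ψ))) * (1 - Real.cos ψ) ^ 2) * (β⁻¹ - T⁻¹) := by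
    calc Real.sqrt T ^ 3 * ∫ U, Real.exp (-(T * (Matrix.trace (1 - (U : Matrix (Fin 2) (Fin 2) ℂ))).re)) ∂(haarProbability (Matrix.specialUnitaryGroup (Fin 2) ℂ)) - Real.sqrt β ^ 3 * ∫ U, Real.exp (-(β * (Matrix.trace (1 - (U : Matrix (Fin 2) (Fin 2) ℂ))).re)) ∂(haarProbability (Matrix.specialUnitaryGroup (Fin 2) ℂ))
        = (Real.sqrt T ^ 3 * ∫ U, Real.exp (-(T * (Matrix.trace (1 - (U : Matrix (Fin 2) (Fin 2) ℂ))).re)) ∂(haarProbability (Matrix.specialUnitaryGroup (Fin 2) ℂ)) - Real.sqrt β ^ 3 * ∫ U, Real.exp (-(β * (Matrix.trace (1 - (U : Matrix (Fin 2) (Fin 2) ℂ))).re)) ∂(haarProbability (Matrix.specialUnitaryGroup (Fin 2) ℂ))) * (c ^ 2)⁻¹ * c ^ 2 := by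
          rw [mul_assoc, inv_mul_cancel₀ (pow_ne_zero 2 hc0.ne'), mul_one]
      _ = (-T⁻¹ - -β⁻¹) * (Real.sqrt c / Real.pi * ∫ ψ in Set.Ioo 0 Real.pi, Real.exp (-(2 * c * (1 - Real.cos ψ))) * (1 - Real.cos ψ) ^ 2) * c ^ 2 := by rw [heq]
      _ = c ^ 2 * (Real.sqrt c / Real.pi * ∫ ψ in Set.Ioo 0 Real.pi, Real.exp (-(2 * c * (1 - Real.cos ψ))) * (1 - Real.cos ψ) ^ 2) * (β⁻¹ - T⁻¹) := by ring
  have hpos : 0 ≤ β⁻¹ - T⁻¹ := sub_nonneg.2 (inv_anti₀ hβp hT.le)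
  have hc' := hL c (hβ.trans hc.1.le)
  rw [hceq]
  exact ⟨mul_le_mul_of_nonneg_right hc'.1 hpos, mul_le_mul_of_nonneg_right hc'.2 hpos⟩
/-- **THE SHARP NEXT-ORDER TERM OF THE ONE-PLAQUETTE MASS (INTEGRATED FORM)**: `β·((2√π)⁻¹ − (√β)³·∫ e^{−β Re tr(1−U)} dHaar_{SU(2)}) → 3∕(32√π)` as `β → ∞` —
J3's sharp ceiling `Z(β) < (2√π)⁻¹β^{−3∕2}` is missed by exactly `(3∕16)(2√π)⁻¹β^{−5∕2}·(1 + o(1))` (§6 + the mean-value bracket, `T → ∞` through V45's limit;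
no integration on `[β, ∞)`). [folklore] -/
theorem tendsto_mul_limit_sub_scaled_plaquetteMass_SU2 :
    Tendsto (fun β : ℝ => β * ((2 * Real.sqrt Real.pi)⁻¹ - Real.sqrt β ^ 3 * ∫ U, Real.exp (-(β * (Matrix.trace (1 - (U : Matrix (Fin 2) (Fin 2) ℂ))).re)) ∂(haarProbability (Matrix.specialUnitaryGroup (Fin 2) ℂ)))) atTop (𝓝 (3 / (32 * Real.sqrt Real.pi))) := by
  have hg : Tendsto (fun x : ℝ => x ^ 2 * (Real.sqrt x / Real.pi * ∫ ψ in Set.Ioo 0 Real.pi, Real.exp (-(2 * x * (1 - Real.cos ψ))) * (1 - Real.cos ψ) ^ 2)) atTop (𝓝 (3 / (32 * Real.sqrt Real.pi))) := by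
    refine tendsto_sq_mul_deriv_scaled_plaquetteMass_SU2.congr' ?_
    filter_upwards [eventually_gt_atTop (0 : ℝ)] with β hβ
    rw [(hasDerivAt_scaled_plaquetteMass_SU2 hβ).deriv]
  have hK := tendsto_scaled_plaquetteMass_SU2
  refine Metric.tendsto_atTop.2 fun ε hε => ?_
  obtain ⟨β₁, hβ₁⟩ := Metric.tendsto_atTop.1 hg (ε / 2) (by linarith)
  have h1pos : 0 < max β₁ 1 := lt_of_lt_of_le one_pos (le_max_right β₁ 1)
  have hLwin : ∀ x : ℝ, max β₁ 1 ≤ x → 3 / (32 * Real.sqrt Real.pi) - ε / 2 ≤ x ^ 2 * (Real.sqrt x / Real.pi * ∫ ψ in Set.Ioo 0 Real.pi, Real.exp (-(2 * x * (1 - Real.cos ψ))) * (1 - Real.cos ψ) ^ 2)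
      ∧ x ^ 2 * (Real.sqrt x / Real.pi * ∫ ψ in Set.Ioo 0 Real.pi, Real.exp (-(2 * x * (1 - Real.cos ψ))) * (1 - Real.cos ψ) ^ 2) ≤ 3 / (32 * Real.sqrt Real.pi) + ε / 2 := fun x hx => by
    have h := hβ₁ x ((le_max_left _ _).trans hx)
    rw [Real.dist_eq, abs_lt] at h
    constructor <;> linarith [h.1, h.2]
  refine ⟨max β₁ 1, fun β hβ => ?_⟩
  have hβp : 0 < β := h1pos.trans_le hβ
  -- the bracket for every `T > β`, then `T → ∞`
  have hlow : ∀ᶠ T : ℝ in atTop, (3 / (32 * Real.sqrt Real.pi) - ε / 2) * (β⁻¹ - T⁻¹) ≤ Real.sqrt T ^ 3 * ∫ U, Real.exp (-(T * (Matrix.trace (1 - (U : Matrix (Fin 2) (Fin 2) ℂ))).re)) ∂(haarProbability (Matrix.specialUnitaryGroup (Fin 2) ℂ)) - Real.sqrt β ^ 3 * ∫ U, Real.exp (-(β * (Matrix.trace (1 - (U : Matrix (Fin 2) (Fin 2) ℂ))).re)) ∂(haarProbability (Matrix.specialUnitaryGroup (Fin 2) ℂ)) := by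
    filter_upwards [eventually_gt_atTop β] with T hT
    exact (scaled_plaquetteMass_SU2_increment_mem h1pos hLwin hβ hT).1
  have hup : ∀ᶠ T : ℝ in atTop, Real.sqrt T ^ 3 * ∫ U, Real.exp (-(T * (Matrix.trace (1 - (U : Matrix (Fin 2) (Fin 2) ℂ))).re)) ∂(haarProbability (Matrix.specialUnitaryGroup (Fin 2) ℂ)) - Real.sqrt β ^ 3 * ∫ U, Real.exp (-(β * (Matrix.trace (1 - (U : Matrix (Fin 2) (Fin 2) ℂ))).re)) ∂(haarProbability (Matrix.specialUnitaryGroup (Fin 2) ℂ)) ≤ (3 / (32 * Real.sqrt Real.pi) + ε / 2) * (β⁻¹ - T⁻¹) := by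
    filter_upwards [eventually_gt_atTop β] with T hT
    exact (scaled_plaquetteMass_SU2_increment_mem h1pos hLwin hβ hT).2
  have hlimF : Tendsto (fun T : ℝ => Real.sqrt T ^ 3 * ∫ U, Real.exp (-(T * (Matrix.trace (1 - (U : Matrix (Fin 2) (Fin 2) ℂ))).re)) ∂(haarProbability (Matrix.specialUnitaryGroup (Fin 2) ℂ)) - Real.sqrt β ^ 3 * ∫ U, Real.exp (-(β * (Matrix.trace (1 - (U : Matrix (Fin 2) (Fin 2) ℂ))).re)) ∂(haarProbability (Matrix.specialUnitaryGroup (Fin 2) ℂ))) atTop (𝓝 ((2 * Real.sqrt Real.pi)⁻¹ - Real.sqrt β ^ 3 * ∫ U, Real.exp (-(β * (Matrix.trace (1 - (U : Matrix (Fin 2) (Fin 2) ℂ))).re)) ∂(haarProbability (Matrix.specialUnitaryGroup (Fin 2) ℂ)))) := hK.sub_const _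
  have hlimB : ∀ C : ℝ, Tendsto (fun T : ℝ => C * (β⁻¹ - T⁻¹)) atTop (𝓝 (C * (β⁻¹ - 0))) := fun C =>
    tendsto_const_nhds.mul (tendsto_const_nhds.sub tendsto_inv_atTop_zero)
  have h1 : (3 / (32 * Real.sqrt Real.pi) - ε / 2) * (β⁻¹ - 0) ≤ (2 * Real.sqrt Real.pi)⁻¹ - Real.sqrt β ^ 3 * ∫ U, Real.exp (-(β * (Matrix.trace (1 - (U : Matrix (Fin 2) (Fin 2) ℂ))).re)) ∂(haarProbability (Matrix.specialUnitaryGroup (Fin 2) ℂ)) :=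
    le_of_tendsto_of_tendsto (hlimB _) hlimF hlow
  have h2 : (2 * Real.sqrt Real.pi)⁻¹ - Real.sqrt β ^ 3 * ∫ U, Real.exp (-(β * (Matrix.trace (1 - (U : Matrix (Fin 2) (Fin 2) ℂ))).re)) ∂(haarProbability (Matrix.specialUnitaryGroup (Fin 2) ℂ)) ≤ (3 / (32 * Real.sqrt Real.pi) + ε / 2) * (β⁻¹ - 0) :=
    le_of_tendsto_of_tendsto hlimF (hlimB _) hup
  rw [sub_zero, ← div_eq_mul_inv, div_le_iff₀ hβp] at h1
  rw [sub_zero, ← div_eq_mul_inv, le_div_iff₀ hβp] at h2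
  rw [Real.dist_eq, abs_lt]
  constructor <;> nlinarith [h1, h2]
/-- **EVENTUALLY, A TWO-SIDED SECOND-ORDER WINDOW FOR THE MASS**: for every `ε > 0` and all large `β`,
`(2√π)⁻¹β^{−3∕2} − (3∕(32√π) + ε)·β^{−5∕2} ≤ Z(β) ≤ (2√π)⁻¹β^{−3∕2} − (3∕(32√π) − ε)·β^{−5∕2}` (written with `(√β)⁻¹`). [folklore] -/
theorem eventually_plaquetteMass_SU2_secondOrder {ε : ℝ} (hε : 0 < ε) :
    ∀ᶠ β : ℝ in atTop,
      ((2 * Real.sqrt Real.pi)⁻¹ - (3 / (32 * Real.sqrt Real.pi) + ε) / β) * ((Real.sqrt β)⁻¹) ^ 3 ≤ ∫ U, Real.exp (-(β * (Matrix.trace (1 - (U : Matrix (Fin 2) (Fin 2) ℂ))).re)) ∂(haarProbability (Matrix.specialUnitaryGroup (Fin 2) ℂ))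
      ∧ ∫ U, Real.exp (-(β * (Matrix.trace (1 - (U : Matrix (Fin 2) (Fin 2) ℂ))).re)) ∂(haarProbability (Matrix.specialUnitaryGroup (Fin 2) ℂ)) ≤ ((2 * Real.sqrt Real.pi)⁻¹ - (3 / (32 * Real.sqrt Real.pi) - ε) / β) * ((Real.sqrt β)⁻¹) ^ 3 := by
  have h := tendsto_mul_limit_sub_scaled_plaquetteMass_SU2
  have hlo := h.eventually_const_lt (show 3 / (32 * Real.sqrt Real.pi) - ε < 3 / (32 * Real.sqrt Real.pi) by linarith)
  have hhi := h.eventually_lt_const (show 3 / (32 * Real.sqrt Real.pi) < 3 / (32 * Real.sqrt Real.pi) + ε by linarith)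
  filter_upwards [hlo, hhi, eventually_gt_atTop (0 : ℝ)] with β h1 h2 hβ
  have hs : 0 < Real.sqrt β := Real.sqrt_pos.2 hβ
  have hs3 : 0 < Real.sqrt β ^ 3 := pow_pos hs 3
  have e : ∫ U, Real.exp (-(β * (Matrix.trace (1 - (U : Matrix (Fin 2) (Fin 2) ℂ))).re)) ∂(haarProbability (Matrix.specialUnitaryGroup (Fin 2) ℂ)) = (Real.sqrt β ^ 3 * ∫ U, Real.exp (-(β * (Matrix.trace (1 - (U : Matrix (Fin 2) (Fin 2) ℂ))).re)) ∂(haarProbability (Matrix.specialUnitaryGroup (Fin 2) ℂ))) * ((Real.sqrt β)⁻¹) ^ 3 := by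
    rw [inv_pow, mul_comm (Real.sqrt β ^ 3), mul_assoc, mul_inv_cancel₀ hs3.ne', mul_one]
  rw [e, inv_pow]
  constructor
  · refine mul_le_mul_of_nonneg_right ?_ (by positivity)
    have : (2 * Real.sqrt Real.pi)⁻¹ - Real.sqrt β ^ 3 * ∫ U, Real.exp (-(β * (Matrix.trace (1 - (U : Matrix (Fin 2) (Fin 2) ℂ))).re)) ∂(haarProbability (Matrix.specialUnitaryGroup (Fin 2) ℂ)) < (3 / (32 * Real.sqrt Real.pi) + ε) / β := by
      rw [lt_div_iff₀ hβ]; linarith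
    linarith
  · refine mul_le_mul_of_nonneg_right ?_ (by positivity)
    have : (3 / (32 * Real.sqrt Real.pi) - ε) / β < (2 * Real.sqrt Real.pi)⁻¹ - Real.sqrt β ^ 3 * ∫ U, Real.exp (-(β * (Matrix.trace (1 - (U : Matrix (Fin 2) (Fin 2) ℂ))).re)) ∂(haarProbability (Matrix.specialUnitaryGroup (Fin 2) ℂ)) := by
      rw [div_lt_iff₀ hβ]; linarith
    linarith
end Summit.QuantumFields.BalabanUV.T4Continuum.NE7b.CompactFibreMeanActionSU2SecondOrder

end
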